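import Mathlib
import HarnessLib
import Summits.HubbardSuperconductivity.HubbardSuperconductivity.Theorems.KLProgrammeKLRegimeTwoVolumeTowerBaseFrameDiffTorusSum

/-!
# Route `KLProgramme` — crux K3, VL child `KLRegimeVolumeLimitV17F2` (stmt-HubbardSuperconductivity-20440), base of the two-volume tower, atom (ii)
# (`hDrow/hDcol` = conjuncts 4–5 of atom `Hbase`) CLOSED UNIFORMLY: with the rates `s₀ := β/M`, `s₁ := 1` the rows and columns of
# `klBaseTransfer L M β μ K′ − klBaseTransfer L M β μ K` are bounded by an EXPLICIT `M`-, `L`-FREE constant times the frame increment `ε`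
# (cell gate-hubbard-kl, seat p3 g18; `--supports` 20440)

Continuation of `…TowerBaseFrameDiffTorusSum` (`torusSum_frameDiff_le`, free rates) and `…TowerBaseFrameDiffRows` (`klBaseTransfer_frameDiff_rows_of_torusSum`):

* `frameDiff_prefactor_le` — `ε_x·(|β|L²)⁻¹·√W(β/M,1)·√(16·4M·L²·N_L) ≤ √(131072·C₁·c_β)` for `β ≥ 1` (`W = 2048(M/β+1)C₁`, `N_L ≤ 2c_βL²`,
  `C₁ = 4(2√2+2)² + 64`, `c_β = (klE0β/π+1)(1793klE0+704)`);
* **`klBaseTransfer_frameDiff_rows_uniform`** — CONJUNCTS 4–5 OF ATOM `Hbase` (DISCHARGER-GUIDE-g16 §2; `hDrow/hDcol` of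
  `towerBase_transferData_of_atoms`, `hdataT` of `exists_towerDataTS_of_readouts`): for two admissible frames `K, K′` of common `C²` size `A` with
  `coeffNorm_j(K′ ⊖ K) ≤ ε` (`j ≤ 2`), rows AND columns of the base-transfer frame difference are `≤ 2·√(131072·C₁·c_β)·(S₀ + T₀β² + π²Ξ/4)` — every term
  `∝ ε`, no `M`, no `L`; on the two volumes' top flow frames `ε = O(1/L)` (`frameIncrement_toLp_data`), so this IS the `δg L → 0` of the bundle.

Hypotheses = the model data of k3c4-p2's thin-pair files (see `…TowerBaseFrameDiffSymbol`).  Proofs only; no definition.  Honest framing: finite-torus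
bookkeeping; nothing here asserts any stub of 20440, K3, VL or superconductivity.  [cite: BenfattoGiulianiMastropietro2006, §2.7 (2.70)–(2.71a), §3 (3.3)]
-/

noncomputable section

namespace Summit.HubbardSuperconductivity.HubbardSuperconductivity.Theorems.TorusFourierL2

set_option linter.dupNamespace false -- summit = problem name (single-conjunct summit), D-0017

open Set Finset Literature.MathematicalPhysics.QuantumLattice Literature.MathematicalPhysics.QuantumLattice.BandSectorCounting
open Literature.MathematicalPhysics.QuantumLattice.FermiRG Literature.Probability.LatticeModels Literature.Analysis.SpecialFunctions
open Summit.HubbardSuperconductivity.HubbardSuperconductivity.Theorems.DispersionFlow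
open Summit.HubbardSuperconductivity.HubbardSuperconductivity.Theorems.KLRegimeSplit
open Summit.HubbardSuperconductivity.HubbardSuperconductivity.Theorems.KLProgrammeLegKernels
open Summit.HubbardSuperconductivity.HubbardSuperconductivity.Theorems.PerturbedFermiCurve
open Summit.HubbardSuperconductivity.HubbardSuperconductivity.Theorems.EngineV8
open scoped Real

/-! ## §5 The rate choice `s₀ := β/M`, `s₁ := 1`: an `M`-, `L`-uniform prefactor, and conjuncts 4–5 of atom `Hbase` -/

section Uniform

open Summit.HubbardSuperconductivity.HubbardSuperconductivity.Theorems.TwoVolumeDefect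
open Summit.HubbardSuperconductivity.HubbardSuperconductivity.Theorems.TwoVolumeSource

/-- **The prefactor algebra**: with `s₀ := β/M`, `s₁ := 1`, `ε_x·(|β|L²)⁻¹·√W·√(16·4M·L²·N_L) ≤ √(131072·C₁·c_β)` for `β ≥ 1`
(`W = 2048(M/β + 1)C₁`, `N_L = 2(klE0β/π+1)(1793klE0L²+704L) ≤ 2c_βL²`, `c_β = (klE0β/π+1)(1793klE0+704)`). [folklore] -/
theorem frameDiff_prefactor_le {L M : ℕ} [NeZero L] [NeZero M] {β C₁ : ℝ} (hβ1 : 1 ≤ β) (hC₁ : 0 ≤ C₁) :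
    imagTimeWeight β M * (1 / (|β| * (L : ℝ) ^ 2)) *
        (Real.sqrt (2048 * (1 / (β / M) + 1) * C₁) *
          Real.sqrt (16 * ((2 * (2 * M) : ℕ) : ℝ) * (L : ℝ) ^ 2 * (2 * ((klE0 * β / π + 1) * (1793 * klE0 * (L : ℝ) ^ 2 + 704 * L))))) ≤
      Real.sqrt (131072 * C₁ * ((klE0 * β / π + 1) * (1793 * klE0 + 704))) := by
  have hβ : 0 < β := by linarith
  have hM1 : (1 : ℝ) ≤ M := by exact_mod_cast Nat.one_le_iff_ne_zero.2 (NeZero.ne M)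
  have hL1 : (1 : ℝ) ≤ L := by exact_mod_cast Nat.one_le_iff_ne_zero.2 (NeZero.ne L)
  have hM0 : (0 : ℝ) < M := by linarith
  have hL0 : (0 : ℝ) < L := by linarith
  have he : (0 : ℝ) ≤ klE0 := by norm_num [klE0]
  have hk : 0 ≤ klE0 * β / π + 1 := by have := Real.pi_pos; positivity
  have hW0 : 0 ≤ 2048 * (1 / (β / M) + 1) * C₁ := by positivity
  -- `ε_x/(|β|L²) = 1/(2ML²)`
  have hεx : imagTimeWeight β M * (1 / (|β| * (L : ℝ) ^ 2)) = 1 / (2 * M * (L : ℝ) ^ 2) := by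
    rw [imagTimeWeight, abs_of_pos hβ]
    field_simp
  rw [hεx, ← Real.sqrt_mul hW0]
  have ha : 0 ≤ 1 / (2 * (M : ℝ) * (L : ℝ) ^ 2) := by positivity
  rw [show 1 / (2 * (M : ℝ) * (L : ℝ) ^ 2) * Real.sqrt (2048 * (1 / (β / M) + 1) * C₁ *
      (16 * ((2 * (2 * M) : ℕ) : ℝ) * (L : ℝ) ^ 2 * (2 * ((klE0 * β / π + 1) * (1793 * klE0 * (L : ℝ) ^ 2 + 704 * L))))) =
      Real.sqrt ((1 / (2 * (M : ℝ) * (L : ℝ) ^ 2)) ^ 2 * (2048 * (1 / (β / M) + 1) * C₁ *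
      (16 * ((2 * (2 * M) : ℕ) : ℝ) * (L : ℝ) ^ 2 * (2 * ((klE0 * β / π + 1) * (1793 * klE0 * (L : ℝ) ^ 2 + 704 * L)))))) by
    rw [Real.sqrt_mul (sq_nonneg _), Real.sqrt_sq ha]]
  refine Real.sqrt_le_sqrt ?_
  -- the radicand: `(M/β + 1) ≤ 2M`, `1793klE0L² + 704L ≤ (1793klE0 + 704)L²`
  have h1 : 1 / (β / M) + 1 ≤ 2 * M := by
    rw [one_div_div]
    have : (M : ℝ) / β ≤ M := div_le_self hM0.le hβ1
    linarith
  have h2 : 1793 * klE0 * (L : ℝ) ^ 2 + 704 * L ≤ (1793 * klE0 + 704) * (L : ℝ) ^ 2 := by nlinarith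
  have hN : (0 : ℝ) ≤ ((2 * (2 * M) : ℕ) : ℝ) := by positivity
  calc (1 / (2 * (M : ℝ) * (L : ℝ) ^ 2)) ^ 2 * (2048 * (1 / (β / M) + 1) * C₁ *
        (16 * ((2 * (2 * M) : ℕ) : ℝ) * (L : ℝ) ^ 2 * (2 * ((klE0 * β / π + 1) * (1793 * klE0 * (L : ℝ) ^ 2 + 704 * L)))))
      ≤ (1 / (2 * (M : ℝ) * (L : ℝ) ^ 2)) ^ 2 * (2048 * (2 * M) * C₁ *
        (16 * ((2 * (2 * M) : ℕ) : ℝ) * (L : ℝ) ^ 2 * (2 * ((klE0 * β / π + 1) * ((1793 * klE0 + 704) * (L : ℝ) ^ 2))))) := by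
        gcongr
    _ = 131072 * C₁ * ((klE0 * β / π + 1) * (1793 * klE0 + 704)) := by
        push_cast
        field_simp
        ring

variable {L M : ℕ} [NeZero L] [NeZero M] {K K' : TrigPolyC4v} {A : ℝ}
  (hA : ∀ p : Momentum, ∀ j ≤ 2, ‖iteratedFDeriv ℝ j (frameShift K) p‖ ≤ A)
  (hA' : ∀ p : Momentum, ∀ j ≤ 2, ‖iteratedFDeriv ℝ j (frameShift K') p‖ ≤ A)
  {μ z β : ℝ} (hz : 0 < z) (hz1 : z ≤ 1) (hgap : klE0 + A + z ^ 2 < -μ) (h3 : klE0 + A - μ ≤ 3) (hβ1 : 1 ≤ β)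
  (hMβ : klE0 * β < π * (2 * M - 3))
  {d : ℝ} (hd : 0 ≤ d) (hd1 : ∀ u, |deriv (bgmCutoffSq klE0) u| ≤ d) (hd2 : ∀ u, |iteratedDeriv 2 (bgmCutoffSq klE0) u| ≤ d)
  (hd3 : ∀ u, |iteratedDeriv 3 (bgmCutoffSq klE0) u| ≤ d)
  {z₁ z₂ : ℝ}
  (hZb : ∀ ω : Fin (sectorCount 0), ∀ p,
    ‖fderiv ℝ (fun p : Fin 2 → ℝ => gnCutoff ((π + z) ^ 2 / π ^ 2) ((π + z) ^ 2) (p 0 ^ 2) * gnCutoff ((π + z) ^ 2 / π ^ 2) ((π + z) ^ 2) (p 1 ^ 2) *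
      (radialCutoffC (1 / 2) (momToComplex p) * sectorWeightCirc 0 ((ω : ℕ) : ℤ) (polarAngle p))) p‖ ≤ z₁ ∧
    ‖iteratedFDeriv ℝ 2 (fun p : Fin 2 → ℝ => gnCutoff ((π + z) ^ 2 / π ^ 2) ((π + z) ^ 2) (p 0 ^ 2) *
      gnCutoff ((π + z) ^ 2 / π ^ 2) ((π + z) ^ 2) (p 1 ^ 2) *
      (radialCutoffC (1 / 2) (momToComplex p) * sectorWeightCirc 0 ((ω : ℕ) : ℤ) (polarAngle p))) p‖ ≤ z₂)
  {ε : ℝ} (hε : ∀ j ≤ 2, (fsub K' K).coeffNorm j ≤ ε)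
  {R : RenConsts} {U : ℝ} {N : ℕ} (hK : FrameOK R U N μ K) (hK' : FrameOK R U N μ K')

set_option maxHeartbeats 800000 in -- one large application of the free-rate bound and the bookkeeping of its amplitude
include hA hA' hz hz1 hgap h3 hβ1 hMβ hd hd1 hd2 hd3 hZb hε hK hK' in
/-- **CONJUNCTS 4–5 OF ATOM `Hbase`, `M`- AND VOLUME-UNIFORM**: for two admissible frames `K, K′` of common `C²` size `A` with `coeffNorm_j(K′ ⊖ K) ≤ ε`
(`j ≤ 2`), `β ≥ 1`, `klE0·β < π(2M−3)`, `4π ≤ zL`: the rows AND columns of `klBaseTransfer L M β μ K′ − klBaseTransfer L M β μ K` are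
`≤ 2·√(131072·C₁·c_β)·(S₀ + T₀β² + π²Ξ/4)` — an explicit constant times `ε`, free of `M`, `L` (`C₁ = 4(2√2+2)² + 64`, `c_β = (klE0β/π+1)(1793klE0+704)`;
`S₀, T₀, Ξ` the sup / time / space constants of `…TowerBaseFrameDiffSymbol`, each `∝ ε`).  On the two volumes' top flow frames `ε = O(1/L)`, so this is the
`δg L → 0` of the base-transfer bundle. [cite: BenfattoGiulianiMastropietro2006, §2.7 (2.70)–(2.71a), §3 (3.3)] -/
theorem klBaseTransfer_frameDiff_rows_uniform (hzL : 2 * |2 * π / (L : ℝ)| ≤ z) :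
    let Cfd : ℝ := Real.sqrt (131072 * (4 * ((2 * Real.sqrt 2 / 1 + 2) * (2 * Real.sqrt 2 / 1 + 2)) + 16 * (1 / 1 + 1) ^ 2) *
        ((klE0 * β / π + 1) * (1793 * klE0 + 704))) *
      (d * klE0 ^ 2 / klScale klE0 0 ^ 2 * (2 * (4 + A + |μ|) * ε * 1) +
        (4 * (d * klE0 ^ 6 / klScale klE0 0 ^ 2) + 2 * (d * klE0 ^ 4 / klScale klE0 0 ^ 2)) *
          (2 * π / β) ^ 2 * (2 * (4 + A + |μ|) * ε * 1) / klScale klE0 0 ^ 2 * β ^ 2 +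
        π ^ 2 *
          (((4 * (d * klE0 ^ 6 / klScale klE0 0 ^ 2) + 2 * (d * klE0 ^ 4 / klScale klE0 0 ^ 2)) * (4 + 2 * A) ^ 2 / klScale klE0 0 ^ 2 +
                2 * (d * klE0 ^ 4 / klScale klE0 0 ^ 2) * (4 + 4 * A) / klScale klE0 0) * (2 * (4 + A + |μ|) * ε * 1) +
            4 * (d * klE0 ^ 4 / klScale klE0 0 ^ 2) * (4 + 2 * A) / klScale klE0 0 *
              (2 * (((4 + 2 * A) * ε + (4 + A + |μ|) * (2 * ε)) * 1 + (4 + A + |μ|) * ε * z₁)) +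
            d * klE0 ^ 2 / klScale klE0 0 ^ 2 *
              (2 * (((4 + 4 * A) * ε + 2 * (4 + 2 * A) * (2 * ε) + (4 + A + |μ|) * (4 * ε)) * 1 +
                2 * ((4 + 2 * A) * ε + (4 + A + |μ|) * (2 * ε)) * z₁ + (4 + A + |μ|) * ε * z₂))) / 4)
    (∀ x : SrcLabel L M 0, ∑ y : GridLeg (GridPoint L (klGridN M)) × Fin 2,
        ‖klBaseTransfer L M β μ K' x y - klBaseTransfer L M β μ K x y‖ ≤ 2 * Cfd) ∧
    (∀ y : GridLeg (GridPoint L (klGridN M)) × Fin 2, ∑ x : SrcLabel L M 0,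
        ‖klBaseTransfer L M β μ K' x y - klBaseTransfer L M β μ K x y‖ ≤ 2 * Cfd) := by
  intro Cfd
  haveI : NeZero (2 * (2 * M)) := ⟨by have := NeZero.ne M; omega⟩
  have hβ : 0 < β := by linarith
  have hM1 : (1 : ℝ) ≤ M := by exact_mod_cast Nat.one_le_iff_ne_zero.2 (NeZero.ne M)
  have hM0 : (0 : ℝ) < M := by linarith
  have hL0 : (0 : ℝ) < L := Nat.cast_pos.2 (Nat.pos_of_ne_zero (NeZero.ne L))
  have hA0 : 0 ≤ A := le_trans (norm_nonneg _) (hA 0 0 (by norm_num))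
  have hε0 : 0 ≤ ε := le_trans (TrigPolyC4v.coeffNorm_nonneg 0 _) (hε 0 (by norm_num))
  have hs : 0 < sectorCount 0 := by simp [sectorCount]
  have hz₁ : 0 ≤ z₁ := le_trans (norm_nonneg _) ((hZb ⟨0, hs⟩ 0).1)
  have hz₂ : 0 ≤ z₂ := le_trans (norm_nonneg _) ((hZb ⟨0, hs⟩ 0).2)
  have he : (0 : ℝ) ≤ klE0 := by norm_num [klE0]
  have hΛ : 0 < klScale klE0 0 := by rw [klScale]; norm_num [klE0]
  have hs₀ : 0 < β / M := by positivity
  -- the free-rate torus bound at `s₀ := β/M`, `s₁ := 1`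
  have hT := fun ω c => torusSum_frameDiff_le hA hA' hz hz1 hgap h3 hβ hMβ hd hd1 hd2 hd3 hZb hε hK hK' hzL hs₀ one_pos ω c
  -- abbreviations
  set S₀ : ℝ := d * klE0 ^ 2 / klScale klE0 0 ^ 2 * (2 * (4 + A + |μ|) * ε * 1) with hS₀
  set T₀ : ℝ := (4 * (d * klE0 ^ 6 / klScale klE0 0 ^ 2) + 2 * (d * klE0 ^ 4 / klScale klE0 0 ^ 2)) *
      (2 * π / β) ^ 2 * (2 * (4 + A + |μ|) * ε * 1) / klScale klE0 0 ^ 2 with hT₀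
  set Ξ : ℝ := (((4 * (d * klE0 ^ 6 / klScale klE0 0 ^ 2) + 2 * (d * klE0 ^ 4 / klScale klE0 0 ^ 2)) * (4 + 2 * A) ^ 2 / klScale klE0 0 ^ 2 +
          2 * (d * klE0 ^ 4 / klScale klE0 0 ^ 2) * (4 + 4 * A) / klScale klE0 0) * (2 * (4 + A + |μ|) * ε * 1) +
      4 * (d * klE0 ^ 4 / klScale klE0 0 ^ 2) * (4 + 2 * A) / klScale klE0 0 *
        (2 * (((4 + 2 * A) * ε + (4 + A + |μ|) * (2 * ε)) * 1 + (4 + A + |μ|) * ε * z₁)) +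
      d * klE0 ^ 2 / klScale klE0 0 ^ 2 *
        (2 * (((4 + 4 * A) * ε + 2 * (4 + 2 * A) * (2 * ε) + (4 + A + |μ|) * (4 * ε)) * 1 +
          2 * ((4 + 2 * A) * ε + (4 + A + |μ|) * (2 * ε)) * z₁ + (4 + A + |μ|) * ε * z₂))) with hΞ
  set C₁ : ℝ := 4 * ((2 * Real.sqrt 2 / 1 + 2) * (2 * Real.sqrt 2 / 1 + 2)) + 16 * (1 / 1 + 1) ^ 2 with hC₁
  set W : ℝ := Real.sqrt (2048 * (1 / (β / M) + 1) * C₁) with hW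
  set Rr : ℝ := Real.sqrt (16 * ((2 * (2 * M) : ℕ) : ℝ) * (L : ℝ) ^ 2 * (2 * ((klE0 * β / π + 1) * (1793 * klE0 * (L : ℝ) ^ 2 + 704 * L)))) with hRr
  have hS₀0 : 0 ≤ S₀ := by rw [hS₀]; positivity
  have hT₀0 : 0 ≤ T₀ := by rw [hT₀]; positivity
  have hΞ0 : 0 ≤ Ξ := by rw [hΞ]; positivity
  have hC₁0 : 0 ≤ C₁ := by rw [hC₁]; positivity
  have hW0 : 0 ≤ W := Real.sqrt_nonneg _
  have hRr0 : 0 ≤ Rr := Real.sqrt_nonneg _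
  -- the amplitude at these rates
  have ht : T₀ / (4 / (β / M * ((2 * (2 * M) : ℕ) : ℝ))) ^ 2 = T₀ * β ^ 2 := by
    have h4 : (4 : ℝ) / (β / M * ((2 * (2 * M) : ℕ) : ℝ)) = 1 / β := by
      push_cast
      field_simp
      ring
    rw [h4]
    field_simp
  have hx : (2 * π / L) ^ 2 * Ξ / (4 / (1 * (L : ℝ))) ^ 2 = π ^ 2 * Ξ / 4 := by
    field_simp
    ring
  set Amp : ℝ := S₀ + T₀ / (4 / (β / M * ((2 * (2 * M) : ℕ) : ℝ))) ^ 2 + (2 * π / L) ^ 2 * Ξ / (4 / (1 * (L : ℝ))) ^ 2 with hAmp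
  have hAmp' : Amp = S₀ + T₀ * β ^ 2 + π ^ 2 * Ξ / 4 := by rw [hAmp, ht, hx]
  have hAmp0 : 0 ≤ Amp := by rw [hAmp']; positivity
  have hCfd : Cfd = Real.sqrt (131072 * C₁ * ((klE0 * β / π + 1) * (1793 * klE0 + 704))) * (S₀ + T₀ * β ^ 2 + π ^ 2 * Ξ / 4) := rfl
  -- the torus bound `Tval` and its nonnegativity
  set Tval : ℝ := 1 / (|β| * (L : ℝ) ^ 2) * (W * Rr * Amp) with hTval
  have hTval0 : 0 ≤ Tval := by rw [hTval]; positivity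
  have hT' : ∀ (ω : Fin (sectorCount 0)) (c : Fin 2), 1 / (|β| * (L : ℝ) ^ 2) *
      ∑ dw : TorusSite 1 (2 * (2 * M)) × TorusSite 2 L,
        ‖∑ k : FreqMomentum L M, (klAnisoFamily L M β μ K' klE0 0 ω k - klAnisoFamily L M β μ K klE0 0 ω k) *
          (if c = 0 then torusChar (fun _ : Fin 1 => ((k.1 : ℕ) : ZMod (2 * (2 * M)))) dw.1 * torusChar k.2 dw.2
            else (starRingEnd ℂ) (torusChar (fun _ : Fin 1 => ((k.1 : ℕ) : ZMod (2 * (2 * M)))) dw.1 * torusChar k.2 dw.2))‖ ≤ Tval := by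
    intro ω c
    rw [hTval]
    exact hT ω c
  obtain ⟨hrow, hcol⟩ := klBaseTransfer_frameDiff_rows_of_torusSum (V := L) (M := M) hβ μ K' K hTval0 hT'
  -- `ε_x · Tval ≤ Cfd`
  have hfin : imagTimeWeight β M * Tval ≤ Cfd := by
    have hpre := frameDiff_prefactor_le (L := L) (M := M) hβ1 hC₁0
    rw [hTval, hCfd, ← hAmp']
    calc imagTimeWeight β M * (1 / (|β| * (L : ℝ) ^ 2) * (W * Rr * Amp))
        = (imagTimeWeight β M * (1 / (|β| * (L : ℝ) ^ 2)) * (W * Rr)) * Amp := by ring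
      _ ≤ Real.sqrt (131072 * C₁ * ((klE0 * β / π + 1) * (1793 * klE0 + 704))) * Amp :=
          mul_le_mul_of_nonneg_right (by rw [hW, hRr]; exact hpre) hAmp0
  refine ⟨fun x => (hrow x).trans ?_, fun y => (hcol y).trans ?_⟩ <;> linarith

end Uniform

end Summit.HubbardSuperconductivity.HubbardSuperconductivity.Theorems.TorusFourierL2

end
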